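import Literature.Probability.Percolation.UniquenessInfiniteCluster
import Literature.Probability.Percolation.ConnectivityProofs
import Literature.Probability.Percolation.FiniteEnergy
import HarnessLib

/-!
# Girdles, I: one-endedness off a box and face arms (`ℤ^d`)

First half of the girdle criterion for `θ(p_c) = 0` (second half and the criterion itself:
`SoloBlindGirdleCriterion.lean`). For a box `Λ_n = [-n, n]^d` we consider open paths *off*
`Λ_n` — none of whose steps has an endpoint in `Λ_n` (step graph `offBox d n`) — the outer faces
`{x ∈ Λ_{n+1} : x_i = ±(n + 1)}` (`boxFace`), the **face-arm events** "some site of the outer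
face `(i, ±)` percolates off `Λ_n`" (`faceArm`) and the **girdle events** "the two opposite outer
faces `±e_i` are joined by an open path off `Λ_n`" (`girdle`).

* `twoArmsOffBox_null`, `ae_oneEnded_offBox` — **one-endedness off a box**: for `p < 1` and
  every `n`, almost surely any two sites percolating off `Λ_n` are joined off `Λ_n`. The event
  `D` that this fails is determined by the edges off `Λ_n`; the event `C` that every edge meeting
  `Λ_n` is closed is determined by the complementary edges and has probability
  `≥ (1 - p)^{#} > 0`; so `P(D ∩ C) = P(D) P(C)` (Grimmett 1999, §2.2, events on disjoint edge
  sets), while on `D ∩ C` there are two infinite open clusters — a null event by uniqueness of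
  the infinite cluster (Aizenman–Kesten–Newman 1987; Burton–Keane 1989; Grimmett 1999,
  Thm. (8.1); tree: `Grimmett1999_numInfiniteClusters_le_one_holds`). Hence `P(D) = 0`.
* `percInBox_inter_subset_someFaceArm` — if a site of `Λ_n` has an infinite open cluster then
  (boundary-dart argument on an open path leaving `Λ_n`) some site of `Λ_{n+1} ∖ Λ_n`, i.e. of
  some outer face, percolates off `Λ_n`.
* `tendsto_real_percInBox`, `tendsto_real_someFaceArm` — if `θ(p) > 0` then
  `P_p(`some site of `Λ_n` percolates`) → 1` (zero–one law for the existence of an infinite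
  cluster, Grimmett 1999, Thm. (1.11); tree: `Grimmett1999_prob_exists_percolatesAt_holds`;
  continuity from below), hence `P_p(`some outer face percolates off `Λ_n`) → 1`.

References: G. Grimmett, *Percolation*, 2nd ed. (Springer, 1999), §1.4 Thm. (1.11), §2.2,
§8.2 Thm. (8.1); M. Aizenman, H. Kesten, C. M. Newman, Comm. Math. Phys. 111 (1987) 505–531;
R. M. Burton, M. Keane, Comm. Math. Phys. 121 (1989) 501–505.
Tree inputs: `withinGraph`, `openClusterIn`, `percolatesVia`, `openConnVia`
(`ConstrainedClusters.lean`), `numInfiniteClusters_le_one_iff`, `mem_box_succ_of_adj`,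
`Grimmett1999_numInfiniteClusters_le_one_holds` (`UniquenessInfiniteCluster.lean`),
`bondPercolation_real_inter_of_disjoint`, `le_bondPercolation_real_forall_notMem`,
`determinedBy_forall_notMem` (`FiniteEnergy.lean`), `Grimmett1999_prob_exists_percolatesAt_holds`
(`ConnectivityProofs.lean`), `SimpleGraph.Walk.exists_boundary_dart`, `SimpleGraph.Walk.transfer`.
-/

namespace Summit.CriticalPhenomena.PercolationContinuityZ3.Theorems

open MeasureTheory ProbabilityTheory Filter Topology
open Literature.Probability.LatticeModels Literature.Probability.Percolation

variable {d : ℕ}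

/-! ### Steps off a box, outer faces, face arms and girdles -/

/-- The graph of steps of `ℤ^d` with both endpoints outside the box `Λ_n`. -/
noncomputable def offBox (d n : ℕ) : SimpleGraph (Site d) :=
  withinGraph (zdGraph d) (↑(box d n) : Set (Site d))ᶜ

/-- Adjacency off the box: a step of `ℤ^d` with both endpoints outside `Λ_n`. -/
theorem offBox_adj {n : ℕ} {u v : Site d} :
    (offBox d n).Adj u v ↔ (zdGraph d).Adj u v ∧ u ∉ box d n ∧ v ∉ box d n := by
  simp [offBox, withinGraph_adj]

/-- The `i`-th coordinate `±(n + 1)` of the outer face of `Λ_n` in direction `(i, up)`. -/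
def boxFaceVal (n : ℕ) : Bool → ℤ
  | true => (n : ℤ) + 1
  | false => -((n : ℤ) + 1)

/-- The upper face value is `n + 1`. -/
@[simp] theorem boxFaceVal_true (n : ℕ) : boxFaceVal n true = (n : ℤ) + 1 := rfl
/-- The lower face value is `-(n + 1)`. -/
@[simp] theorem boxFaceVal_false (n : ℕ) : boxFaceVal n false = -((n : ℤ) + 1) := rfl

/-- The outer face of `Λ_n` in direction `(i, up)`: the sites of `Λ_{n+1}` with `i`-th coordinate
`n + 1` (`up = true`) resp. `-(n + 1)` (`up = false`). -/
def boxFace (d n : ℕ) (i : Fin d) (up : Bool) : Set (Site d) :=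
  {a | a ∈ box d (n + 1) ∧ a i = boxFaceVal n up}

/-- The **face-arm event**: some site of the outer face `(i, up)` of `Λ_n` has an infinite open
cluster made of steps avoiding `Λ_n`. -/
def faceArm (d n : ℕ) (i : Fin d) (up : Bool) : Set (BondConfig (Site d)) :=
  ⋃ a ∈ boxFace d n i up, percolatesVia (offBox d n) a

/-- The **girdle event** in direction `i`: some site of the outer face `x_i = n + 1` of `Λ_n` is
joined to some site of the opposite outer face `x_i = -(n + 1)` by an open path none of whose
steps has an endpoint in `Λ_n`. -/
def girdle (d n : ℕ) (i : Fin d) : Set (BondConfig (Site d)) :=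
  ⋃ a ∈ boxFace d n i true, ⋃ b ∈ boxFace d n i false, openConnVia (offBox d n) a b

/-- Membership in the face-arm event, unfolded. -/
theorem mem_faceArm {n : ℕ} {i : Fin d} {up : Bool} {ω : BondConfig (Site d)} :
    ω ∈ faceArm d n i up ↔ ∃ a ∈ boxFace d n i up, ω ∈ percolatesVia (offBox d n) a := by
  simp only [faceArm, Set.mem_iUnion₂, exists_prop]

/-- Membership in the girdle event, unfolded: two sites of opposite outer faces in one open
cluster of steps off `Λ_n`. -/
theorem mem_girdle {n : ℕ} {i : Fin d} {ω : BondConfig (Site d)} :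
    ω ∈ girdle d n i ↔
      ∃ a ∈ boxFace d n i true, ∃ b ∈ boxFace d n i false, b ∈ openClusterIn (offBox d n) ω a := by
  simp only [girdle, Set.mem_iUnion₂, exists_prop, openConnVia, Set.mem_setOf_eq]

/-- Face arms are measurable (a countable union of the events `{a ↔ ∞ off Λ_n}`). -/
theorem measurableSet_faceArm (n : ℕ) (i : Fin d) (up : Bool) : MeasurableSet (faceArm d n i up) :=
  MeasurableSet.biUnion (Set.to_countable _) fun a _ => measurableSet_percolatesVia _ a

/-- Face arms are increasing events. -/
theorem isUpperSet_faceArm (n : ℕ) (i : Fin d) (up : Bool) : IsUpperSet (faceArm d n i up) :=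
  isUpperSet_iUnion₂ fun a _ => isUpperSet_percolatesVia _ a

/-- Girdles are measurable. -/
theorem measurableSet_girdle (n : ℕ) (i : Fin d) : MeasurableSet (girdle d n i) :=
  MeasurableSet.biUnion (Set.to_countable _) fun a _ =>
    MeasurableSet.biUnion (Set.to_countable _) fun b _ => measurableSet_openConnVia _ a b

/-! ### One-endedness off a box (finite energy + uniqueness) -/

/-- The pairs of sites of `Λ_{n+1}` with at least one member in `Λ_n`; they contain every edge
of `ℤ^d` with an endpoint in `Λ_n`. -/
noncomputable def boxInnerPairs (d n : ℕ) : Finset (Sym2 (Site d)) :=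
  (box d (n + 1)).sym2 \ (box d (n + 1) \ box d n).sym2

/-- Every edge of `ℤ^d` with an endpoint in `Λ_n` is one of the pairs `boxInnerPairs d n`. -/
theorem mk_mem_boxInnerPairs_of_adj {n : ℕ} {a b : Site d} (ha : a ∈ box d n)
    (hab : (zdGraph d).Adj a b) : s(a, b) ∈ boxInnerPairs d n := by
  rw [boxInnerPairs, Finset.mem_sdiff, Finset.mk_mem_sym2_iff, Finset.mk_mem_sym2_iff,
    Finset.mem_sdiff]
  exact ⟨⟨box_mono d (Nat.le_succ n) ha, mem_box_succ_of_adj ha hab⟩, fun h => h.1.2 ha⟩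

/-- The pairs `boxInnerPairs d n` are not steps off `Λ_n`. -/
theorem disjoint_boxInnerPairs_edgeSet (n : ℕ) :
    Disjoint (↑(boxInnerPairs d n) : Set (Sym2 (Site d))) (offBox d n).edgeSet := by
  rw [Set.disjoint_left]
  intro e he he'
  rw [Finset.mem_coe] at he
  induction e using Sym2.ind with
  | h a b =>
    rw [SimpleGraph.mem_edgeSet, offBox_adj] at he'
    rw [boxInnerPairs, Finset.mem_sdiff, Finset.mk_mem_sym2_iff, Finset.mk_mem_sym2_iff,
      Finset.mem_sdiff, Finset.mem_sdiff] at he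
    exact he.2 ⟨⟨he.1.1, he'.2.1⟩, ⟨he.1.2, he'.2.2⟩⟩

/-- The event "two sites percolate by steps off `Λ_n` without being joined off `Λ_n`". -/
def twoArmsOffBox (d n : ℕ) : Set (BondConfig (Site d)) :=
  ⋃ a : Site d, ⋃ b : Site d,
    (percolatesVia (offBox d n) a ∩ percolatesVia (offBox d n) b ∩ (openConnVia (offBox d n) a b)ᶜ)

/-- `twoArmsOffBox d n` is measurable. -/
theorem measurableSet_twoArmsOffBox (n : ℕ) : MeasurableSet (twoArmsOffBox d n) :=
  MeasurableSet.iUnion fun a => MeasurableSet.iUnion fun b =>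
    ((measurableSet_percolatesVia _ a).inter (measurableSet_percolatesVia _ b)).inter
      (measurableSet_openConnVia _ a b).compl

/-- `twoArmsOffBox d n` is determined by the steps off `Λ_n`. -/
theorem determinedBy_twoArmsOffBox (n : ℕ) :
    DeterminedBy (twoArmsOffBox d n) (offBox d n).edgeSet := by
  rw [determinedBy_iff]
  intro ω ω' h
  simp only [twoArmsOffBox, Set.mem_iUnion, Set.mem_inter_iff, Set.mem_compl_iff, percolatesVia,
    openConnVia, Set.mem_setOf_eq, openClusterIn, h]

/-- If every pair of `boxInnerPairs d n` is closed (and `ω ⊆ E(ℤ^d)`), an open path of `ℤ^d` is an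
open path off `Λ_n`. -/
theorem mem_openClusterIn_offBox_of_reachable {n : ℕ} {ω : BondConfig (Site d)}
    (hωE : ω ⊆ (zdGraph d).edgeSet) (hC : ∀ e ∈ boxInnerPairs d n, e ∉ ω) {a b : Site d}
    (h : (openGraph ω).Reachable a b) : b ∈ openClusterIn (offBox d n) ω a := by
  obtain ⟨w⟩ := h
  rw [mem_openClusterIn_iff]
  refine ⟨w.transfer (openGraph ω ⊓ offBox d n) ?_⟩
  intro e he
  have heω := w.edges_subset_edgeSet he
  induction e using Sym2.ind with
  | h u v =>
    rw [SimpleGraph.mem_edgeSet] at heω ⊢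
    have huv : s(u, v) ∈ ω := ((openGraph_adj ω u v).1 heω).1
    have hadj : (zdGraph d).Adj u v := ((zdGraph d).mem_edgeSet).1 (hωE huv)
    have hu : u ∉ box d n := fun hu => hC _ (mk_mem_boxInnerPairs_of_adj hu hadj) huv
    have hv : v ∉ box d n := fun hv =>
      hC _ (mk_mem_boxInnerPairs_of_adj hv hadj.symm) (by rw [Sym2.eq_swap]; exact huv)
    rw [SimpleGraph.inf_adj, offBox_adj]
    exact ⟨heω, hadj, hu, hv⟩

/-- **One-endedness off a box is almost sure** (`p < 1`): the event `twoArmsOffBox d n` is null.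
Finite energy: it is independent of "all pairs of `boxInnerPairs d n` closed", which has positive
probability, and their intersection forces two infinite open clusters. -/
theorem twoArmsOffBox_null (n : ℕ) (p : unitInterval) (hp1 : (p : ℝ) < 1) :
    bondPercolation (zdGraph d) p (twoArmsOffBox d n) = 0 := by
  classical
  set μ := bondPercolation (zdGraph d) p with hμ
  set C : Set (BondConfig (Site d)) := {ω | ∀ e ∈ boxInnerPairs d n, e ∉ ω} with hC_def
  have hCpos : 0 < μ.real C :=
    lt_of_lt_of_le (pow_pos (by linarith) _)
      (le_bondPercolation_real_forall_notMem (zdGraph d) p (boxInnerPairs d n))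
  have hind : μ.real (twoArmsOffBox d n ∩ C) = μ.real (twoArmsOffBox d n) * μ.real C :=
    bondPercolation_real_inter_of_disjoint (zdGraph d) p (disjoint_boxInnerPairs_edgeSet n).symm
      (determinedBy_twoArmsOffBox n) (determinedBy_forall_notMem (boxInnerPairs d n))
      (measurableSet_twoArmsOffBox n) (measurableSet_forall_notMem (boxInnerPairs d n))
  have hAE : μ {ω : BondConfig (Site d) | ω ⊆ (zdGraph d).edgeSet}ᶜ = 0 := by
    rw [Set.compl_setOf]
    exact ae_iff.1 (setBernoulli_ae_subset (u := (zdGraph d).edgeSet) (p := p))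
  have hN : μ {ω : BondConfig (Site d) | numInfiniteClusters ω ≤ 1}ᶜ = 0 := by
    rw [Set.compl_setOf]
    exact ae_iff.1 (Grimmett1999_numInfiniteClusters_le_one_holds d p)
  have hsub : twoArmsOffBox d n ∩ C ⊆
      {ω | numInfiniteClusters ω ≤ 1}ᶜ ∪ {ω : BondConfig (Site d) | ω ⊆ (zdGraph d).edgeSet}ᶜ := by
    rintro ω ⟨hω, hωC⟩
    by_contra hcon
    simp only [Set.mem_union, Set.mem_compl_iff, Set.mem_setOf_eq, not_or, not_not] at hcon
    obtain ⟨hN1, hωE⟩ := hcon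
    simp only [twoArmsOffBox, Set.mem_iUnion, Set.mem_inter_iff, Set.mem_compl_iff] at hω
    obtain ⟨a, b, ⟨ha, hb⟩, hab⟩ := hω
    exact hab (mem_openClusterIn_offBox_of_reachable hωE hωC
      ((numInfiniteClusters_le_one_iff ω).1 hN1 a b (percolatesVia_subset_percolatesAt _ a ha)
        (percolatesVia_subset_percolatesAt _ b hb)))
  have hnull : μ (twoArmsOffBox d n ∩ C) = 0 := measure_mono_null hsub (measure_union_null hN hAE)
  have h0 : μ.real (twoArmsOffBox d n) * μ.real C = 0 := by
    rw [← hind, measureReal_def, hnull, ENNReal.toReal_zero]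
  rcases mul_eq_zero.1 h0 with h | h
  · exact (measureReal_eq_zero_iff (measure_ne_top μ _)).1 h
  · exact absurd h hCpos.ne'

/-- Almost surely, any two sites percolating by steps off `Λ_n` are joined off `Λ_n`. -/
theorem ae_oneEnded_offBox (n : ℕ) (p : unitInterval) (hp1 : (p : ℝ) < 1) :
    ∀ᵐ ω ∂(bondPercolation (zdGraph d) p), ∀ a b, ω ∈ percolatesVia (offBox d n) a →
      ω ∈ percolatesVia (offBox d n) b → b ∈ openClusterIn (offBox d n) ω a := by
  have h0 := twoArmsOffBox_null (d := d) n p hp1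
  have h1 : ∀ᵐ ω ∂(bondPercolation (zdGraph d) p), ω ∉ twoArmsOffBox d n := by
    rw [ae_iff]
    simpa only [not_not, Set.setOf_mem_eq] using h0
  filter_upwards [h1] with ω hω a b ha hb
  by_contra hab
  exact hω (Set.mem_iUnion.2 ⟨a, Set.mem_iUnion.2 ⟨b, ⟨ha, hb⟩, hab⟩⟩)

/-! ### An infinite cluster meeting `Λ_n` makes some outer face percolate off `Λ_n` -/

/-- If a site of `Λ_n` has an infinite open cluster (and `ω ⊆ E(ℤ^d)`), some site of
`Λ_{n+1} ∖ Λ_n` percolates by steps off `Λ_n`. -/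
theorem exists_percolatesVia_offBox {n : ℕ} {ω : BondConfig (Site d)}
    (hωE : ω ⊆ (zdGraph d).edgeSet) {x : Site d} (hx : x ∈ box d n) (hperc : ω ∈ percolatesAt x) :
    ∃ a ∈ box d (n + 1), a ∉ box d n ∧ ω ∈ percolatesVia (offBox d n) a := by
  classical
  have hcover : openCluster ω x \ ↑(box d n) ⊆
      ⋃ a ∈ (↑(box d (n + 1) \ box d n) : Set (Site d)), openClusterIn (offBox d n) ω a := by
    rintro z ⟨hz, hzn⟩
    rw [Finset.mem_coe] at hzn
    obtain ⟨w⟩ := (hz : (openGraph ω).Reachable x z).symm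
    let S : Set (Site d) := {v | v ∈ openClusterIn (offBox d n) ω z ∧ v ∉ box d n}
    obtain ⟨e, -, he1, he2⟩ :=
      w.exists_boundary_dart S ⟨self_mem_openClusterIn _ _ _, hzn⟩ (fun h => h.2 hx)
    have hmem : s(e.fst, e.snd) ∈ ω := ((openGraph_adj ω _ _).1 e.adj).1
    have hadj : (zdGraph d).Adj e.fst e.snd := ((zdGraph d).mem_edgeSet).1 (hωE hmem)
    by_cases hb : e.snd ∈ box d n
    · refine Set.mem_iUnion₂.2 ⟨e.fst, ?_, ?_⟩
      · rw [Finset.mem_coe, Finset.mem_sdiff]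
        exact ⟨mem_box_succ_of_adj hb hadj.symm, he1.2⟩
      · rw [openClusterIn_eq_of_mem he1.1]
        exact self_mem_openClusterIn _ _ _
    · exact absurd (mem_openClusterIn_of_adj he1.1 (offBox_adj.2 ⟨hadj, he1.2, hb⟩) hmem)
        (fun h => he2 ⟨h, hb⟩)
  have hinf : (openCluster ω x \ ↑(box d n)).Infinite := hperc.sdiff (Finset.finite_toSet _)
  by_contra hcon
  push Not at hcon
  have hfin : (⋃ a ∈ (↑(box d (n + 1) \ box d n) : Set (Site d)),
      openClusterIn (offBox d n) ω a).Finite := by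
    refine Set.Finite.biUnion (Finset.finite_toSet _) fun a ha => ?_
    rw [Finset.mem_coe, Finset.mem_sdiff] at ha
    exact Set.not_infinite.1 (hcon a ha.1 ha.2)
  exact (hinf.mono hcover) hfin

/-- A site of `Λ_{n+1} ∖ Λ_n` lies on some outer face of `Λ_n`. -/
theorem exists_mem_boxFace {n : ℕ} {a : Site d} (ha1 : a ∈ box d (n + 1)) (ha : a ∉ box d n) :
    ∃ i up, a ∈ boxFace d n i up := by
  obtain ⟨i, hi⟩ : ∃ i, ¬ (-(n : ℤ) ≤ a i ∧ a i ≤ n) := by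
    by_contra h
    push Not at h
    exact ha (mem_box.2 h)
  have h1 := (mem_box.1 ha1) i
  push_cast at h1
  rcases le_or_gt (-(n : ℤ)) (a i) with hle | hlt
  · refine ⟨i, true, ha1, ?_⟩
    rw [boxFaceVal_true]
    omega
  · refine ⟨i, false, ha1, ?_⟩
    rw [boxFaceVal_false]
    omega

/-- The event "some site of `Λ_n` has an infinite open cluster". -/
def percInBox (d n : ℕ) : Set (BondConfig (Site d)) :=
  ⋃ x ∈ (↑(box d n) : Set (Site d)), percolatesAt x

/-- The event "some outer face of `Λ_n` percolates off `Λ_n`". -/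
def someFaceArm (d n : ℕ) : Set (BondConfig (Site d)) :=
  ⋃ k : Fin d × Bool, faceArm d n k.1 k.2

/-- If some site of `Λ_n` percolates (and `ω ⊆ E(ℤ^d)`), some outer face of `Λ_n` percolates off
`Λ_n`. -/
theorem percInBox_inter_subset_someFaceArm (n : ℕ) :
    percInBox d n ∩ {ω | ω ⊆ (zdGraph d).edgeSet} ⊆ someFaceArm d n := by
  rintro ω ⟨hω, hωE⟩
  simp only [percInBox, Set.mem_iUnion, exists_prop, Finset.mem_coe] at hω
  obtain ⟨x, hx, hperc⟩ := hω
  obtain ⟨a, ha1, ha, hpa⟩ := exists_percolatesVia_offBox hωE hx hperc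
  obtain ⟨i, up, hface⟩ := exists_mem_boxFace ha1 ha
  exact Set.mem_iUnion.2 ⟨(i, up), mem_faceArm.2 ⟨a, hface, hpa⟩⟩

/-- If `θ(p) > 0` then `P_p(`some site of `Λ_n` percolates`) → 1` (zero–one law for the existence
of an infinite cluster and continuity from below). -/
theorem tendsto_real_percInBox (p : unitInterval) (hθ : 0 < theta (zdGraph d) (0 : Site d) p) :
    Tendsto (fun n => (bondPercolation (zdGraph d) p).real (percInBox d n)) atTop (𝓝 1) := by
  set μ := bondPercolation (zdGraph d) p with hμ
  have hmono : Monotone (percInBox d) := fun m n hmn =>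
    Set.biUnion_subset_biUnion_left (Finset.coe_subset.2 (box_mono d hmn))
  have hU : (⋃ n, percInBox d n) = {ω | ∃ x, ω ∈ percolatesAt x} := by
    ext ω
    simp only [percInBox, Set.mem_iUnion, exists_prop, Finset.mem_coe, Set.mem_setOf_eq]
    constructor
    · rintro ⟨n, x, -, hx⟩
      exact ⟨x, hx⟩
    · rintro ⟨x, hx⟩
      refine ⟨Finset.univ.sup fun i => (x i).natAbs, x, mem_box.2 fun i => ?_, hx⟩
      have hi : (x i).natAbs ≤ Finset.univ.sup fun i => (x i).natAbs :=
        Finset.le_sup (f := fun i => (x i).natAbs) (Finset.mem_univ i)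
      generalize (Finset.univ.sup fun i => (x i).natAbs) = m at hi ⊢
      omega
  have h1 : μ.real {ω | ∃ x, ω ∈ percolatesAt x} = 1 :=
    (Grimmett1999_prob_exists_percolatesAt_holds d p).2 hθ
  have htend : Tendsto (fun n => μ.real (percInBox d n)) atTop
      (𝓝 (μ.real (⋃ n, percInBox d n))) :=
    (ENNReal.tendsto_toReal (measure_ne_top μ _)).comp (tendsto_measure_iUnion_atTop hmono)
  rwa [hU, h1] at htend

/-- If `θ(p) > 0` then `P_p(`some outer face of `Λ_n` percolates off `Λ_n`) → 1`. -/
theorem tendsto_real_someFaceArm (p : unitInterval) (hθ : 0 < theta (zdGraph d) (0 : Site d) p) :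
    Tendsto (fun n => (bondPercolation (zdGraph d) p).real (someFaceArm d n)) atTop (𝓝 1) := by
  set μ := bondPercolation (zdGraph d) p with hμ
  have hAE : μ {ω : BondConfig (Site d) | ω ⊆ (zdGraph d).edgeSet}ᶜ = 0 := by
    rw [Set.compl_setOf]
    exact ae_iff.1 (setBernoulli_ae_subset (u := (zdGraph d).edgeSet) (p := p))
  have hle : ∀ n, μ.real (percInBox d n) ≤ μ.real (someFaceArm d n) := fun n =>
    calc μ.real (percInBox d n)
        = μ.real (percInBox d n ∩ {ω | ω ⊆ (zdGraph d).edgeSet}) := by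
          rw [measureReal_def, measureReal_def, measure_inter_conull hAE]
      _ ≤ μ.real (someFaceArm d n) := measureReal_mono (percInBox_inter_subset_someFaceArm n)
  exact tendsto_of_tendsto_of_tendsto_of_le_of_le (tendsto_real_percInBox p hθ) tendsto_const_nhds
    hle (fun n => measureReal_le_one)

end Summit.CriticalPhenomena.PercolationContinuityZ3.Theorems
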